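import Mathlib
import Summits.ValiantsHypothesis.ValiantsHypothesis.Theses.FeketeSOS
import Summits.ValiantsHypothesis.ValiantsHypothesis.Theorems.FeketeSOSSublinearShadowQfSquares
import Summits.ValiantsHypothesis.ValiantsHypothesis.Theorems.FeketeSOSSublinearShadowQfModelField
import Summits.ValiantsHypothesis.ValiantsHypothesis.Theorems.FeketeSOSSublinearShadowWindowTransfer

/-!
# `FeketeSOS.SublinearShadow` (stmt-ValiantsHypothesis-14990), line `Sketch`, reshape 6 — stub `stub_gramWindowShadow`

**Gram-window transfer.**  Let `Σ_{i<s} c_i g_i² = F_p` over a field `F` and let `O ∋ p` be a valuation subring of `F`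
(`p` an odd prime) carrying a WINDOW DATUM: a ring map `ψ : O → K[T]/(T^{v+1})` to a truncated polynomial ring over a
field `K` of characteristic `p`, an element `w ∈ O` and an exponent `θ` with `ψ(w^θ) ≠ 0`.  If the GRAM MATRIX
`Q_{ab} = Σ_i c_i g_{i,a} g_{i,b}` is `w^θ`-integral (`w^θ Q_{ab} ∈ O` for all `a, b`), then `F̄_p` has a cyclic
characteristic-`p` shadow with `≤ (2v+2)·2s²` weighted squares of degree `< p` and total support `≤ (2v+2)·2s²·S`:

1. integral quadratic-form model (`stub_qfModelField`, p141154, the maximal-minor normal form over `O`):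
   `F_p = Σ c_i g_i² = Σ_{j,j'<r} Q_{a_j a_{j'}} h_j h_{j'}` with `r ≤ s`, `h_j ∈ O[X]` supported on `U = ∪ supp g_i`;
2. multiply by `w^θ` and polarise over `O` (`2` is a unit of `O` because `p` is odd and `p ∈ 𝔪_O`):
   `w^θ · F_p = Σ_t λ_t q_t²` with `2r²` terms, `λ_t = ± w^θ Q_{a_j a_{j'}}/4 ∈ O`, `q_t = h_j ± h_{j'} ∈ O[X]`;
3. window transfer (`stub_windowTransfer`, p141471): the identity in `O[X]` seen through `ψ` is a window model over `K`, hence a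
   shadow over `K̄` by the landed DFT de-bordering.

The case `v = θ = 0`, `ψ =` the residue map, `F = ℂ` is `stub_gramShadow` (p139058).
-/

namespace Summit.ValiantsHypothesis.ValiantsHypothesis.Theorems.SublinearShadowSketch

open Polynomial Finset IsLocalRing Matrix
open scoped BigOperators

-- `Summit.ValiantsHypothesis.ValiantsHypothesis.…` is the tree's mandated single-conjunct layout (Sub = Summit).
set_option linter.dupNamespace false


/-- `2` is a unit in a valuation subring (indeed in any local ring) whose maximal ideal contains an odd prime `p`:
`u·2 + v·p = 1`. -/
theorem gws_isUnit_two {F : Type} [Field F] (O : ValuationSubring F) {p : ℕ} (hp : p.Prime) (hp2 : p ≠ 2)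
    (hpO : ((p : ℕ) : O) ∈ maximalIdeal O) : IsUnit (2 : O) := by
  have hcop : Nat.Coprime 2 p := by
    rw [Nat.coprime_primes Nat.prime_two hp]
    exact fun h => hp2 h.symm
  have hZ : IsCoprime ((2 : ℕ) : ℤ) (p : ℤ) := Nat.isCoprime_iff_coprime.mpr hcop
  obtain ⟨u, v, huv⟩ := hZ
  have hO : (u : O) * 2 + (v : O) * (p : O) = 1 := by
    have h := congrArg (Int.cast : ℤ → O) huv
    push_cast at h
    exact h
  by_contra hnu
  have h2 : (2 : O) ∈ maximalIdeal O := (mem_maximalIdeal _).mpr (mem_nonunits_iff.mpr hnu)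
  have h1 : (1 : O) ∈ maximalIdeal O := by
    rw [← hO]
    exact Ideal.add_mem _ (Ideal.mul_mem_left _ _ h2) (Ideal.mul_mem_left _ _ hpO)
  exact (maximalIdeal.isMaximal O).ne_top ((Ideal.eq_top_iff_one _).mpr h1)

/-- With `p` odd in `𝔪_O`: `(2 : F) ≠ 0` and `2⁻¹ ∈ O`. -/
theorem gws_inv_two_mem {F : Type} [Field F] (O : ValuationSubring F) {p : ℕ} (hp : p.Prime) (hp2 : p ≠ 2)
    (hpO : ((p : ℕ) : O) ∈ maximalIdeal O) : (2 : F) ≠ 0 ∧ (2 : F)⁻¹ ∈ O := by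
  obtain ⟨u, hu⟩ := gws_isUnit_two O hp hp2 hpO
  have h1 : (((u⁻¹ : Oˣ) : O) : F) * 2 = 1 := by
    have h : ((u⁻¹ : Oˣ) : O) * (u : O) = 1 := u.inv_mul
    have h' := congrArg (fun z : O => (z : F)) h
    simp only [MulMemClass.coe_mul, OneMemClass.coe_one, hu] at h'
    have e2 : ((2 : O) : F) = 2 := by norm_cast
    rwa [e2] at h'
  have h2 : (2 : F) ≠ 0 := by
    intro h0; rw [h0, mul_zero] at h1; exact zero_ne_one h1
  refine ⟨h2, ?_⟩
  have h3 : (2 : F)⁻¹ = (((u⁻¹ : Oˣ) : O) : F) :=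
    calc (2 : F)⁻¹ = 1 * (2 : F)⁻¹ := (one_mul _).symm
      _ = (((u⁻¹ : Oˣ) : O) : F) * 2 * 2⁻¹ := by rw [h1]
      _ = (((u⁻¹ : Oˣ) : O) : F) := mul_inv_cancel_right₀ h2 _
  rw [h3]; exact SetLike.coe_mem _

/-- `x ∈ O ⇒ x / 4 ∈ O` once `2⁻¹ ∈ O`. -/
theorem gws_div_four_mem {F : Type} [Field F] (O : ValuationSubring F) (h2inv : (2 : F)⁻¹ ∈ O) {x : F}
    (hx : x ∈ O) : x / 4 ∈ O := by
  have h4 : x / 4 = x * 2⁻¹ * 2⁻¹ := by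
    rw [div_eq_mul_inv, show (4 : F) = 2 * 2 by norm_num, mul_inv, mul_assoc]
  rw [h4]
  exact mul_mem (mul_mem hx h2inv) h2inv

/-- A polynomial over `F` all of whose coefficients lie in the valuation subring `O` is the image of a polynomial over
`O` with the same support. -/
theorem gws_exists_lift {F : Type} [Field F] (O : ValuationSubring F) {h : F[X]} (hh : ∀ n, h.coeff n ∈ O) :
    ∃ H : O[X], H.map (algebraMap O F) = h ∧ H.support = h.support := by
  have hl : h ∈ Polynomial.lifts (algebraMap O F) := by
    rw [lifts_iff_coeff_lifts]
    intro n
    exact ⟨⟨h.coeff n, hh n⟩, rfl⟩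
  obtain ⟨H, hH⟩ := (mem_lifts h).mp hl
  refine ⟨H, hH, ?_⟩
  rw [← hH]
  exact (support_map_of_injective H (IsFractionRing.injective O F)).symm

/-- **`stub_gramWindowShadow` (registered stub W4 of line `Sketch`, reshape 6): the Gram-window transfer.**  See the
module docstring. -/
theorem stub_gramWindowShadow (p : ℕ) [Fact p.Prime] (hp2 : p ≠ 2) {F : Type} [Field F] (s : ℕ) (c : Fin s → F)
    (g : Fin s → F[X])
    (hrep : (∑ i, C (c i) * g i ^ 2) = ∑ m ∈ Finset.range p, C ((legendreSym p m : ℤ) : F) * X ^ m)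
    (O : ValuationSubring F) (hpO : ((p : ℕ) : O) ∈ maximalIdeal O)
    (K : Type) [Field K] [CharP K p] (v : ℕ) (ψ : O →+* AdjoinRoot ((X : K[X]) ^ (v + 1))) (w : O) (θ : ℕ)
    (hw : ψ (w ^ θ) ≠ 0)
    (hgram : ∀ a b : ℕ, (w : F) ^ θ * (∑ i, c i * (g i).coeff a * (g i).coeff b) ∈ O) :
    ∃ (K' : Type) (_ : Field K') (_ : CharP K' p) (d : ℕ) (c' : Fin d → K') (g' : Fin d → Polynomial K'),
      d ≤ (2 * v + 2) * (2 * (s * s)) ∧ (∀ j, (g' j).natDegree < p) ∧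
      (∑ j, (g' j).support.card) ≤ (2 * v + 2) * (2 * (s * s)) * ∑ i, (g i).support.card ∧
      ((X : Polynomial K') ^ p - 1 ∣ (∑ j, C (c' j) * g' j ^ 2)
        - ∑ m ∈ Finset.range p, C ((legendreSym p m : ℤ) : K') * X ^ m) := by
  classical
  have hprime : p.Prime := Fact.out
  obtain ⟨h2, h2inv⟩ := gws_inv_two_mem O hprime hp2 hpO
  have hinj : Function.Injective (algebraMap O F) := IsFractionRing.injective O F
  set U : Finset ℕ := Finset.univ.biUnion fun i => (g i).support with hU
  have hUcard : U.card ≤ ∑ i, (g i).support.card := Finset.card_biUnion_le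
  -- (1) the integral quadratic-form model
  obtain ⟨r, a, h, hr, hhint, hhsupp, _hδ, _hexp, hqf⟩ := stub_qfModelField O s c g
  set B : Fin r → Fin r → F := fun j j' =>
    (w : F) ^ θ * ∑ i, c i * (g i).coeff (a j) * (g i).coeff (a j') with hB
  have hBint : ∀ j j', B j j' ∈ O := fun j j' => hgram (a j) (a j')
  -- (2) `w^θ · F_p` as an `O`-integral quadratic form, polarised into `2r²` weighted squares
  have hwF : C ((w : F) ^ θ) * (∑ m ∈ Finset.range p, C ((legendreSym p m : ℤ) : F) * X ^ m)
      = ∑ j, ∑ j', C (B j j') * (h j * h j') := by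
    rw [← hrep, hqf, Finset.mul_sum]
    refine Finset.sum_congr rfl fun j _ => ?_
    rw [Finset.mul_sum]
    refine Finset.sum_congr rfl fun j' _ => ?_
    rw [← mul_assoc, ← C_mul]
  obtain ⟨e⟩ : Nonempty (Fin (2 * (r * r)) ≃ Fin 2 × (Fin r × Fin r)) :=
    ⟨(((Equiv.refl (Fin 2)).prodCongr finProdFinEquiv).trans finProdFinEquiv).symm⟩
  obtain ⟨lamF, hlamF⟩ : ∃ lamF : Fin (2 * (r * r)) → F, ∀ t, lamF t =
      if (e t).1 = 0 then B (e t).2.1 (e t).2.2 / 4 else -(B (e t).2.1 (e t).2.2 / 4) := ⟨_, fun _ => rfl⟩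
  obtain ⟨qF, hqF⟩ : ∃ qF : Fin (2 * (r * r)) → F[X], ∀ t, qF t =
      if (e t).1 = 0 then h (e t).2.1 + h (e t).2.2 else h (e t).2.1 - h (e t).2.2 := ⟨_, fun _ => rfl⟩
  have hpol : (∑ t, C (lamF t) * qF t ^ 2) = ∑ j, ∑ j', C (B j j') * (h j * h j') := by
    rw [← qfs_sum_prod h2 r B h, ← Equiv.sum_comp e]
    simp only [hlamF, hqF]
  have hlamint : ∀ t, lamF t ∈ O := fun t => by
    rw [hlamF]
    split_ifs
    · exact gws_div_four_mem O h2inv (hBint _ _)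
    · exact neg_mem (gws_div_four_mem O h2inv (hBint _ _))
  have hqint : ∀ t n, (qF t).coeff n ∈ O := fun t n => by
    rw [hqF]
    split_ifs
    · rw [coeff_add]; exact add_mem (hhint _ _) (hhint _ _)
    · rw [coeff_sub]; exact sub_mem (hhint _ _) (hhint _ _)
  have hqsupp : ∀ t, (qF t).support ⊆ U := fun t => by
    rw [hqF]
    exact (qfs_support h (e t)).trans (Finset.union_subset (hhsupp _) (hhsupp _))
  -- (3) lift the polarised identity to `O[X]`
  choose Q hQ hQsupp using fun t => gws_exists_lift O (hqint t)
  set lamO : Fin (2 * (r * r)) → O := fun t => ⟨lamF t, hlamint t⟩ with hlamO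
  have hrepO : C (w ^ θ) * (∑ m ∈ Finset.range p, C ((legendreSym p m : ℤ) : O) * X ^ m)
      = ∑ t, C (lamO t) * Q t ^ 2 := by
    apply Polynomial.map_injective (algebraMap O F) hinj
    rw [Polynomial.map_mul, map_C, map_pow, Polynomial.map_sum, Polynomial.map_sum]
    have lhs : ∀ m : ℕ, (C ((legendreSym p m : ℤ) : O) * X ^ m).map (algebraMap O F)
        = C ((legendreSym p m : ℤ) : F) * X ^ m := fun m => by
      rw [Polynomial.map_mul, Polynomial.map_pow, map_C, map_X, map_intCast]
    have rhs : ∀ t, (C (lamO t) * Q t ^ 2).map (algebraMap O F) = C (lamF t) * qF t ^ 2 := fun t => by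
      rw [Polynomial.map_mul, Polynomial.map_pow, map_C, hQ]
      rfl
    simp only [lhs, rhs]
    rw [hpol, ← hwF]
    rfl
  -- (4) window transfer
  obtain ⟨K', instF', instC', d, c', g', hd, hdeg, hcard, hdvd⟩ :=
    stub_windowTransfer p (2 * (r * r)) lamO Q (w ^ θ) hrepO K v ψ hw
  -- (5) bookkeeping
  have hrs : 2 * (r * r) ≤ 2 * (s * s) := Nat.mul_le_mul_left 2 (Nat.mul_le_mul hr hr)
  have hsuppQ : (∑ t, (Q t).support.card) ≤ 2 * (s * s) * ∑ i, (g i).support.card :=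
    calc (∑ t, (Q t).support.card) ≤ ∑ _t : Fin (2 * (r * r)), U.card :=
          Finset.sum_le_sum fun t _ => by rw [hQsupp t]; exact Finset.card_le_card (hqsupp t)
      _ = 2 * (r * r) * U.card := by simp
      _ ≤ 2 * (s * s) * ∑ i, (g i).support.card := Nat.mul_le_mul hrs hUcard
  refine ⟨K', instF', instC', d, c', g', hd.trans (Nat.mul_le_mul_left _ hrs), hdeg, ?_, hdvd⟩
  calc (∑ j, (g' j).support.card) ≤ (2 * v + 2) * ∑ t, (Q t).support.card := hcard
    _ ≤ (2 * v + 2) * (2 * (s * s) * ∑ i, (g i).support.card) := Nat.mul_le_mul_left _ hsuppQ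
    _ = (2 * v + 2) * (2 * (s * s)) * ∑ i, (g i).support.card := (mul_assoc _ _ _).symm

end Summit.ValiantsHypothesis.ValiantsHypothesis.Theorems.SublinearShadowSketch
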